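import Summits.CriticalPhenomena.PercolationContinuityZ3.Theorems.Transplant.Slab111SK4Defs
import HarnessLib

/-!
# Triangular film `𝕋 × {0,1}`, I: the KERNEL CHECKER for `ShapedLinkage 3 (TriFilm.hexShadow 1)` — a base-12 bitboard model of a radius-`4` block of `𝕋 × {0..k}`

builds on p205010 (kernel theorem, internal audit signed; external expert review pending) — NOT used in this file.  Lane `prim-bschramm`, seat
`prim-bschramm-p2` (gen 39; class C1b; memo `HOME/bschramm/P2-LATTICES.md` §138); helper file (`--supports stmt-CriticalPhenomena-4575 --as helper`).

WHY.  The triangular films `𝕋 × {0..k}` die at their own critical point independently of p205010 for every `k ≥ 2` («TriFilmLinkage»: the T‖ template needs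
three layers) and for `k = 0` («TriFilmZero»: Wierman); `k = 1` is closed by name only («TriFilmCriticalContinuityAll», via p205010).  The instance node
`ShapedLinkage 3 (TriFilm.hexShadow 1)` («HexShadowVRouteData»; consumer «HexShadowVLinkageNode».`TriFilm.theta_criticalProb_eq_zero_of_shapedLinkage`) is
finite and kernel-checkable: this file is «Slab111SK4Defs» (the base-12 bitboard of gen 38) with the TRIANGULAR-FILM adjacency — a vertex `(z + (a,b), L)` over
`hexBall z 4`, `L ≤ k ≤ 9`, is the bit `i = 144·L + 12·(a+6) + (b+6)`; the planar steps are the index offsets `±1, ±11, ±12`, the vertical steps `±144`; there is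
no sublattice condition.  Surgery radius `3`: the rerouting block has `triNorm ≤ 3`, the universe `triNorm ≤ 4`.  Layout-free parts are reused from «Slab111SKDefs»
/«Slab111SK4Defs» (`bitOf`, `sdiff`, `maskBelow`, `maskOfList`, `endsOK`, `orFold`, `rd`, `rdMask`, the digits `dL4/dA4/dB4`, `lowIdx4`, `colSlots4`).
Soundness: «TriFilmSKBits» … «TriFilmSKCase».
[cite: DuminilCopinSidoraviciusTassion2016, §2.3 (proof of Fact 2: the three disjoint paths in B_R(z))]
-/

namespace Summit.CriticalPhenomena.PercolationContinuityZ3.Theorems.Transplant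

namespace TriFilm.SKT

open Slab111.SK (bitOf sdiff maskBelow maskOfList endsOK orFold rd rdMask)
open Slab111.SK4 (dL4 dA4 dB4 lowIdx4 colSlots4)

/-! ## §1 The bitboard -/

/-- Index adjacency: the two indices differ by a planar offset `1, 11, 12` or the vertical offset `144`. [folklore] -/
def adjBT (i j : ℕ) : Bool :=
  j == i + 1 || j == i + 11 || j == i + 12 || j == i + 144 || i == j + 1 || i == j + 11 || i == j + 12 || i == j + 144

/-- **The neighbourhood of a vertex set** inside the universe `u`: eight shifts. [folklore] -/
def nbhT (u m : ℕ) : ℕ :=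
  ((m <<< 1) ||| (m <<< 11) ||| (m <<< 12) ||| (m <<< 144) ||| (m >>> 1) ||| (m >>> 11) ||| (m >>> 12) ||| (m >>> 144)) &&& u

/-- Iterated neighbourhood inside `region` (fuel-bounded, stops at the fixpoint). [folklore] -/
def reachGoT (u region : ℕ) : ℕ → ℕ → ℕ
  | 0, cur => cur
  | f + 1, cur => let nxt := (cur ||| nbhT u cur) &&& region; bif nxt == cur then cur else reachGoT u region f nxt

/-- **All vertices reachable from `src ∩ region` by steps inside `region`.** [folklore] -/
def reachT (u region src : ℕ) : ℕ := reachGoT u region 300 (src &&& region)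

/-- BFS layers from the last layer outward inside `reg`, until the layer containing `s` (fuel-bounded). [folklore] -/
def layersGoT (u reg s : ℕ) : ℕ → List ℕ → ℕ → Option (List ℕ)
  | 0, _, _ => none
  | f + 1, layers, vis =>
    match layers with
    | [] => none
    | cur :: _ =>
      let nxt := sdiff (nbhT u cur &&& reg) vis
      bif nxt == 0 then none else bif Nat.testBit nxt s then some (nxt :: layers) else layersGoT u reg s f (nxt :: layers) (vis ||| nxt)

/-- Walking down the BFS layers from `cur`, always to the lowest-index neighbour in the next layer. [folklore] -/
def walkDownT (u : ℕ) : List ℕ → ℕ → List ℕ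
  | [], cur => [cur]
  | L :: rest, cur => cur :: walkDownT u rest (lowIdx4 (nbhT u (bitOf cur) &&& L))

/-- **The canonical shortest path from `s` to `t`** with all other vertices in `reg` (none if there is none). [folklore] -/
def bfsPathT (u reg s t : ℕ) : Option (List ℕ) :=
  bif s == t then some [s] else
    match layersGoT u (reg ||| bitOf s ||| bitOf t) s 90 [bitOf t] (bitOf t) with
    | some (_ :: rest) => some (walkDownT u rest s)
    | _ => none

/-- Re-validation of an index path: all vertices in `reg`, consecutive indices adjacent, no repeated index. [folklore] -/
def pathOKT (reg : ℕ) : List ℕ → ℕ → Bool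
  | [], _ => true
  | [i], seen => Nat.testBit reg i && !Nat.testBit seen i
  | i :: j :: rest, seen => Nat.testBit reg i && !Nat.testBit seen i && adjBT i j && pathOKT reg (j :: rest) (seen ||| bitOf i)

/-! ## §2 The case context -/

/-- **A case**: thickness `k ≤ 9`, clip parameters of the rerouting block (`tR, sR`; `3` = unclipped) and window bounds (`wT, wS`; `4` or more =
unconstrained), and the instance's cleared mask `W`. [folklore] -/
structure CtxT where
  /-- thickness -/
  k : ℕ
  /-- `t`-clip of the rerouting block: `a ≤ tR` -/
  tR : ℕ
  /-- `s`-clip of the rerouting block: `a + b ≤ sR` -/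
  sR : ℕ
  /-- window bound in the `t` direction (`a ≤ wT`) -/
  wT : ℕ
  /-- window bound in the `s` direction (`a + b ≤ wS`) -/
  wS : ℕ
  /-- the cleared vertex mask -/
  W : ℕ

/-- An index is a film vertex over `hexBall z 4` (digits in range, `triNorm ≤ 4`, layer `≤ k`). [folklore] -/
def CtxT.validB (C : CtxT) (i : ℕ) : Bool :=
  decide (i < 1440) && decide (2 ≤ dA4 i) && decide (dA4 i ≤ 10) && decide (2 ≤ dB4 i) && decide (dB4 i ≤ 10) && decide (8 ≤ dA4 i + dB4 i) &&
    decide (dA4 i + dB4 i ≤ 16) && decide (dL4 i ≤ C.k)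

/-- The universe mask. [folklore] -/
def CtxT.univ (C : CtxT) : ℕ := maskBelow C.validB 1440

/-- Column test: over the rerouting block `blkR 3 z tR sR` (`triNorm ≤ 3`, `a ≤ tR`, `a + b ≤ sR`). [folklore] -/
def CtxT.inRB (C : CtxT) (i : ℕ) : Bool :=
  C.validB i && decide (3 ≤ dA4 i) && decide (dA4 i ≤ 9) && decide (3 ≤ dB4 i) && decide (dB4 i ≤ 9) && decide (9 ≤ dA4 i + dB4 i) &&
    decide (dA4 i + dB4 i ≤ 15) && decide (dA4 i ≤ C.tR + 6) && decide (dA4 i + dB4 i ≤ C.sR + 12)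

/-- Window test (`a ≤ wT`, `a + b ≤ wS`). [folklore] -/
def CtxT.inWinB (C : CtxT) (i : ℕ) : Bool := C.validB i && decide (dA4 i ≤ C.wT + 6) && decide (dA4 i + dB4 i ≤ C.wS + 12)

/-- Centre-column test. [folklore] -/
def CtxT.cenB (C : CtxT) (i : ℕ) : Bool := C.validB i && (dA4 i == 6) && (dB4 i == 6)

/-- The rerouting mask `W ∩ \overline{blkR}`. [folklore] -/
def CtxT.WR (C : CtxT) : ℕ := C.W &&& maskBelow C.inRB 1440
/-- The window mask. [folklore] -/
def CtxT.win (C : CtxT) : ℕ := maskBelow C.inWinB 1440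
/-- The centre-column mask. [folklore] -/
def CtxT.cen (C : CtxT) : ℕ := maskBelow C.cenB 1440

/-- The column mask of an index (all universe vertices with the same column digits). [folklore] -/
def CtxT.colM (C : CtxT) (i : ℕ) : ℕ := (colSlots4 <<< (i % 144)) &&& C.univ

/-- The list of universe neighbours of an index. [folklore] -/
def CtxT.nbrList (C : CtxT) (e : ℕ) : List ℕ :=
  [e + 1, e + 11, e + 12, e + 144, e - 1, e - 11, e - 12, e - 144].filter fun j => adjBT e j && Nat.testBit C.univ j

/-! ## §3 The certified-terminal filter -/

/-- Outside neighbours: window film vertices adjacent to `e` not in `W`. [folklore] -/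
def CtxT.outs (C : CtxT) (e : ℕ) : List ℕ := (C.nbrList e).filter fun j => Nat.testBit C.win j && !Nat.testBit C.W j
/-- Window neighbours of `e`. [folklore] -/
def CtxT.ins (C : CtxT) (e : ℕ) : List ℕ := (C.nbrList e).filter fun j => Nat.testBit C.win j

/-- The witness condition of a quadruple `(o₁, a₁, o₂, a₂)` for the pair `(e₁, e₂)` (the distinctness clauses of `HexShadow.Terminals.nbrs`). [folklore] -/
def CtxT.quadOK (C : CtxT) (e1 e2 o1 a1 o2 a2 : ℕ) : Bool :=
  (a1 != o1) && (a1 != e2) && (o2 != o1) && (o2 != a1) && (a2 != o2) && (a2 != e1) && (a2 != o1) && ((a1 != a2) || Nat.testBit C.cen a1)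

/-- **The need mask of an ordered terminal pair**: all `w'` for which `(E₁, E₂, w')` passes the bitboard mirror of `HexShadow.Terminals`.
[cite: DuminilCopinSidoraviciusTassion2016, §2.3 (proof of Fact 2: u', v', w')] -/
def CtxT.needMask (C : CtxT) (e1 e2 : ℕ) : ℕ :=
  orFold (C.outs e1) fun o1 => orFold (C.ins e1) fun a1 => orFold (C.outs e2) fun o2 => orFold (C.ins e2) fun a2 =>
    bif C.quadOK e1 e2 o1 a1 o2 a2 then
      sdiff C.W (C.cen ||| C.colM e1 ||| C.colM e2 ||| C.colM o1 ||| C.colM a1 ||| C.colM a2 ||| C.colM o2)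
    else 0

/-- **The terminal list**: rerouting vertices off the centre column with an outside neighbour, in increasing order. [folklore] -/
def CtxT.esList (C : CtxT) : List ℕ := (List.range 1440).filter fun i => Nat.testBit C.WR i && !Nat.testBit C.cen i && !(C.outs i).isEmpty

/-! ## §4 Plans and their cover masks -/

/-- **The cover mask of a plan** `(c₁, y, b, c₂, avoid)` for the pair `(e₁, e₂)`: all `w'` reachable from `b` off routing 1 and from `y` off routing 2,
where routing 1 is the canonical path `e₁ ⇝ c₁ → y ⇝ e₂` and routing 2 is `e₁ ⇝ c₂ → b ⇝ e₂`; `0` if the plan is invalid.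
[cite: DuminilCopinSidoraviciusTassion2016, §2.3 (proof of Fact 2)] -/
def CtxT.coverOf (C : CtxT) (e1 e2 c1 y b c2 avoid : ℕ) : ℕ :=
  let u := C.univ
  let W := C.W
  let WR := C.WR
  let static := (e1 != e2) && (y != b) && (y != e1) && (b != e1) && (b != e2) && (c1 != e2) && (c2 != e2) && (y != e2) &&
    ((c1 == e1) || Nat.testBit WR c1) && ((c2 == e1) || Nat.testBit WR c2) && Nat.testBit WR y && Nat.testBit WR b && Nat.testBit W b &&
    adjBT c1 y && adjBT c1 b && adjBT c2 y && adjBT c2 b && (c1 != y) && (c1 != b) && (c2 != y) && (c2 != b) &&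
    Nat.testBit u e1 && Nat.testBit u e2 && Nat.testBit WR e1 && Nat.testBit WR e2 &&
    ((avoid &&& (bitOf e1 ||| bitOf e2 ||| bitOf c1 ||| bitOf c2 ||| bitOf y ||| bitOf b)) == 0)
  bif !static then 0 else
  let regA := sdiff WR (bitOf y ||| bitOf b ||| bitOf e2 ||| avoid)
  match bfsPathT u regA e1 c1 with
  | none => 0
  | some A =>
    let mA := maskOfList A
    let regY := sdiff WR (mA ||| bitOf b ||| avoid)
    match bfsPathT u regY y e2 with
    | none => 0
    | some Y =>
      let sp1 := mA ||| maskOfList Y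
      bif !(pathOKT (WR ||| bitOf e1 ||| bitOf c1) A 0 && endsOK A e1 c1 && pathOKT (sdiff (WR ||| bitOf e2) mA) Y 0 && endsOK Y y e2) then 0 else
      let good1 := reachT u (sdiff W sp1) (bitOf b)
      let oA2 := bif c2 == c1 then some A else bfsPathT u regA e1 c2
      match oA2 with
      | none => 0
      | some A2 =>
        let mA2 := maskOfList A2
        let regB := sdiff WR (mA2 ||| bitOf y ||| avoid)
        match bfsPathT u regB b e2 with
        | none => 0
        | some B =>
          let sp2 := mA2 ||| maskOfList B
          bif !(pathOKT (WR ||| bitOf e1 ||| bitOf c2) A2 0 && endsOK A2 e1 c2 && pathOKT (sdiff (WR ||| bitOf e2) mA2) B 0 && endsOK B b e2) then 0 else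
          let good2 := reachT u (sdiff W sp2) (bitOf y)
          good1 &&& good2

/-! ## §5 Certificates and the chunk checker -/

/-- Read `cnt` plans for the pair `(e₁, e₂)` and accumulate their cover masks. [folklore] -/
def CtxT.rdPlans (C : CtxT) (e1 e2 : ℕ) : ℕ → ℕ → ℕ → ℕ × ℕ
  | 0, n, acc => (acc, n)
  | cnt + 1, n, acc =>
    let p1 := rd n; let p2 := rd p1.2; let p3 := rd p2.2; let p4 := rd p3.2; let p5 := rd p4.2
    let av := rdMask p5.1 p5.2 0
    let cov := C.coverOf e1 e2 p1.1 p2.1 p3.1 p4.1 av.1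
    C.rdPlans e1 e2 cnt av.2 (bif cov == 0 then acc else acc ||| cov)

/-- Check all partners `e₂` of `e₁` against the certificate numeral `n`. [folklore] -/
def CtxT.checkRow (C : CtxT) (e1 : ℕ) : List ℕ → ℕ → Bool
  | [], _ => true
  | e2 :: rest, n =>
    bif e2 == e1 then C.checkRow e1 rest n else
    let need := C.needMask e1 e2
    bif need == 0 then C.checkRow e1 rest n else
    let p := rd n
    let r := C.rdPlans e1 e2 p.1 p.2 0
    bif sdiff need r.1 == 0 then C.checkRow e1 rest r.2 else false

/-- **The chunk checker**: the rows of the listed terminals `es₁` against one certificate numeral each. [folklore] -/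
def CtxT.checkEs (C : CtxT) : List ℕ → List ℕ → Bool
  | [], _ => true
  | e1 :: rest, certs =>
    match certs with
    | [] => false
    | n :: certs' => bif C.checkRow e1 C.esList n then C.checkEs rest certs' else false

/-- The instance's mask is admissible: inside the cleared block restricted as the case prescribes (`W ⊆ allowed`) and containing every universe vertex of
`hexBall z 1` in it (`forced ⊆ W`). [folklore] -/
def CtxT.wOK (C : CtxT) (allowed forced : ℕ) : Bool := (sdiff C.W allowed == 0) && (sdiff forced C.W == 0)

end TriFilm.SKT

end Summit.CriticalPhenomena.PercolationContinuityZ3.Theorems.Transplant
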